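import Literature.Barriers.CriticalPhenomena.RigorousRGSmallParameterLocTranslation
import Literature.Barriers.CriticalPhenomena.RigorousRGSmallParameterTphiHeat
import HarnessLib

/-!
# `RigorousRGSmallParameter` (Slade, Theorem 1.4.1): the functionals of Slade §4.3 — `ℒ_C`,
# `F_C(A,B)`, `W_j(V,x)`, `P_j(V)_x` and `φ_pt(V)_x` — and the `x`-independence of their
# coefficients by translation covariance

Companion ("proof architecture") file of
`Literature/Barriers/CriticalPhenomena/RigorousRGSmallParameter.lean`. Slade's Theorem 6.3.1 (whose
iterated output is the named fact `LongRangePhi4.Slade2017_prop822`) concerns the maps `R_+, K_+`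
of [BS-rg-step], with `R_+(V,K) = φ_pt(V̂) - φ_pt(V)` (§6.3); the quadratic map `φ_pt = φ_{pt,j}`
("perturbation theory") is DEFINED in §4.3 from the Laplacian `ℒ_C = ½Σ_iΣ_{u,v}C_{u,v}∂_{φ^i_u}∂_{φ^i_v}`
(4.9), `F_C(A,B) = e^{ℒ_C}(e^{-ℒ_C}A)(e^{-ℒ_C}B) - AB` (4.10),
`W_j(V,x) = ½Σ(1 - Loc_x)F_{w_j}(V_x, V(Λ))` (4.11), `φ_pt(V) = e^{ℒ_{C_{j+1}}}V - P_j(V)` (4.13),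
`P_j(V)_x = Loc_x(e^{ℒ}W_j(V,x) + ½F_{C_{j+1}}(e^{ℒ}V_x, e^{ℒ}V(Λ)))` (4.14), with the remark that
"by translation invariance, `P_j(V)_x` does define a local polynomial with coefficients independent
of `x`". (Its explicit evaluation, Proposition 5.1.1, is the computation of [BBS-rg-pt] and is
NOT in this file; the tree's perturbative files `…PerturbativeCoefficients` etc. encode that
explicit form.) This file formalizes the definitions (4.9)–(4.14) as functionals in `𝒩` for the
concrete model — `e^{±ℒ_C}` as the terminating exponential series of `…TphiHeat` (`expLap`), `Loc_x`
as `Loc_{{x}}` of `…LocOperator` with base point `x`, `V_x`, `V(Λ)` of `…LocalPolynomial` — and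
PROVES the quoted remark: every piece is translation covariant, hence the coefficient vector of
`P_j(V)_x` in the basis `P̂_C({x})` is independent of `x` (`betaVec_Pfun_add`).

Conventions: `τ_x = ½|φ_x|²` and `ℒ_C = ½Δ_C` (so `E_Cθ = e^{ℒ_C}` on polynomials, [BBS-rg-pt]);
the covariance `C_{u,v}` is lifted diagonally to the field labels (`lapCov`).

Sources: G. Slade, *Critical exponents for long-range O(n) models below the upper critical
dimension*, Commun. Math. Phys. 358 (2018), arXiv:1611.06169, §4.3 (displays (4.9)–(4.14) and
the following sentence), read from the TeX source; R. Bauerschmidt, D. C. Brydges, G. Slade,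
[BBS-rg-pt] (J. Stat. Phys. 159 (2015) 492–529, arXiv:1403.7252) §2 (conventions `E θ A = e^{½Δ_C}A`,
`F_C`); D. C. Brydges, G. Slade [BS-rg-loc] Proposition 1.4.3 (translation covariance of `Loc`).

## What this file provides (definitions with proved properties; no named fact)

* `lapCov` (the diagonal lift), **`expL`** (`e^{tΔ_C}`; `e^{ℒ_C} = expL C A (1/2)`), `contDiff_expL`,
  **`FC`** ((4.10)), `contDiff_FC`, **`locPt`** (`Loc_x`), **`Wfun`** ((4.11)), **`Pfun`** ((4.14)),
  **`phiPtFun`** ((4.13)).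
* `TransInv` (translation-invariant covariance), `transN_lapC`, `transN_lapPow`, **`transN_expL`**,
  **`transN_FC`**, `transN_localPoly`, `transN_localPolySum_univ`, **`transN_locPt`**,
  `contDiff_locPt`, **`transN_Wfun`**, `contDiff_Wfun`, **`transN_Pfun`**, and
  **`betaVec_Pfun_add`** (the coefficients of `P_j(V)_x` do not depend on `x`).

## References

* [Slade2017] G. Slade, *Critical exponents for long-range O(n) models below the upper critical
  dimension*, Commun. Math. Phys. 358 (2018) 343–436, arXiv:1611.06169 — §4.3.
* [BrydgesSlade2015RGII] D. C. Brydges, G. Slade, *A renormalisation group method. II.*,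
  J. Stat. Phys. 159 (2015) 461–491, arXiv:1403.7253 — Proposition 1.4.3.
-/

noncomputable section

namespace Literature.Barriers.CriticalPhenomena

namespace LongRangePhi4

namespace PTFun

open Finset Tphi RGNorm LocalPoly Loc Polymer Literature.Probability.LatticeModels
open scoped ContDiff

variable {d M n : ℕ} [NeZero M]

/-! ### The Laplacian `ℒ_C = ½Δ_C` on `𝒩` for a lattice covariance, and `e^{±ℒ_C}` on polynomials -/

/-- A lattice covariance `C : Λ × Λ → ℝ` lifted diagonally to the field labels `𝚲 = Λ × {1,…,n}`:
`C_{(u,i),(v,j)} = δ_{ij} C_{uv}`, so that `Δ_C = Σ_i Σ_{u,v} C_{uv} ∂_{φ^i_u}∂_{φ^i_v}`. [cite: Slade2017, §4.3 (display (4.9), ℒ_C = ½Σ_i Σ_{u,v} C_{u,v} ∂/∂φ^i_u ∂/∂φ^i_v)] -/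
def lapCov (C : TorusSite d M → TorusSite d M → ℝ) : TorusSite d M × Fin n → TorusSite d M × Fin n → ℝ :=
  fun p q => if p.2 = q.2 then C p.1 q.1 else 0

/-- **`e^{tΔ_C}` on polynomials of degree `≤ 2A`** (the exponential series terminates; `ℒ_C = ½Δ_C`,
so `e^{ℒ_C} = expL C A (1/2)`, `e^{-ℒ_C} = expL C A (-1/2)`). [cite: Slade2017, §4.3 ("the exponential is defined by power series expansion, which terminates when applied to a polynomial")] -/
def expL (C : TorusSite d M → TorusSite d M → ℝ) (A : ℕ) (t : ℝ) (F : (TorusSite d M → Fin n → ℝ) → ℝ) :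
    (TorusSite d M → Fin n → ℝ) → ℝ :=
  expLap (basisDir d M n) (lapCov C) A t F

/-- `e^{tΔ_C}F` is smooth for smooth `F`. [folklore] -/
theorem contDiff_expL (C : TorusSite d M → TorusSite d M → ℝ) (A : ℕ) (t : ℝ) {F : (TorusSite d M → Fin n → ℝ) → ℝ}
    (hF : ContDiff ℝ ∞ F) : ContDiff ℝ ∞ (expL C A t F) := by
  unfold expL expLap
  exact ContDiff.sum fun k _ => contDiff_const.mul (contDiff_lapPow _ _ hF k)

/-- **`F_C(A,B) = e^{ℒ_C}(e^{-ℒ_C}A · e^{-ℒ_C}B) - AB`** (display (4.10) of [Slade2017]; [BBS-rg-pt]). [cite: Slade2017, §4.3 (display (4.10))] -/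
def FC (C : TorusSite d M → TorusSite d M → ℝ) (A : ℕ) (P Q : (TorusSite d M → Fin n → ℝ) → ℝ) :
    (TorusSite d M → Fin n → ℝ) → ℝ :=
  fun φ => expL C A 2⁻¹ (fun ψ => expL C A (-2⁻¹) P ψ * expL C A (-2⁻¹) Q ψ) φ - P φ * Q φ

/-- `F_C(A,B)` is smooth for smooth `A, B`. [folklore] -/
theorem contDiff_FC (C : TorusSite d M → TorusSite d M → ℝ) (A : ℕ) {P Q : (TorusSite d M → Fin n → ℝ) → ℝ}
    (hP : ContDiff ℝ ∞ P) (hQ : ContDiff ℝ ∞ Q) : ContDiff ℝ ∞ (FC C A P Q) :=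
  (contDiff_expL C A _ ((contDiff_expL C A _ hP).mul (contDiff_expL C A _ hQ))).sub (hP.mul hQ)

/-! ### `Loc_x`, `W_j`, `P_j`, `φ_pt` (displays (4.11)–(4.14)) -/

/-- **`Loc_x = Loc_{{x}}`**, the localisation at the single point `x` with base point `x` (field
dimension `dφ = [φ]_j`, maximal dimension `dplus = d`). [cite: Slade2017, §4.3 ("Loc_x … is the map Loc_X with X = {x}")] -/
def locPt (pN : ℕ) (dφ dplus : ℝ) (x : TorusSite d M) (G : (TorusSite d M → Fin n → ℝ) → ℝ) :
    (TorusSite d M → Fin n → ℝ) → ℝ :=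
  locX pN dφ dplus x {x} G

/-- **`W_j(V,x) = ½(1 - Loc_x)F_{w_j}(V_x, V(Λ))`** (display (4.11) of [Slade2017]) for the local
polynomial `V = gτ² + ντ + u`, `w = w_j = Σ_{i≤j} C_i`. [cite: Slade2017, §4.3 (display (4.11))] -/
def Wfun (pN : ℕ) (dφ dplus : ℝ) (w : TorusSite d M → TorusSite d M → ℝ) (A : ℕ) (g ν u : ℝ) (x : TorusSite d M) :
    (TorusSite d M → Fin n → ℝ) → ℝ :=
  fun φ => 2⁻¹ * (FC w A (localPoly g ν u x) (localPolySum g ν u univ) φ -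
    locPt pN dφ dplus x (FC w A (localPoly g ν u x) (localPolySum g ν u univ)) φ)

/-- **`P_j(V)_x = Loc_x(e^{ℒ_{C_{j+1}}}W_j(V,x) + ½F_{C_{j+1}}(e^{ℒ}V_x, e^{ℒ}V(Λ)))`** (display (4.14)). [cite: Slade2017, §4.3 (display (4.14))] -/
def Pfun (pN : ℕ) (dφ dplus : ℝ) (C w : TorusSite d M → TorusSite d M → ℝ) (A : ℕ) (g ν u : ℝ) (x : TorusSite d M) :
    (TorusSite d M → Fin n → ℝ) → ℝ :=
  locPt pN dφ dplus x fun φ => expL C A 2⁻¹ (Wfun pN dφ dplus w A g ν u x) φ +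
    2⁻¹ * FC C A (expL C A 2⁻¹ (localPoly g ν u x)) (expL C A 2⁻¹ (localPolySum g ν u univ)) φ

/-- **`φ_pt(V)_x = e^{ℒ_{C_{j+1}}}V_x - P_j(V)_x`** (display (4.13)), as a functional located at
`x`; by translation covariance its coefficients do not depend on `x` (`betaPt_Pfun_add`), and
Proposition 5.1.1 of [Slade2017] gives them explicitly. [cite: Slade2017, §4.3 (display (4.13))] -/
def phiPtFun (pN : ℕ) (dφ dplus : ℝ) (C w : TorusSite d M → TorusSite d M → ℝ) (A : ℕ) (g ν u : ℝ) (x : TorusSite d M) :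
    (TorusSite d M → Fin n → ℝ) → ℝ :=
  fun φ => expL C A 2⁻¹ (localPoly g ν u x) φ - Pfun pN dφ dplus C w A g ν u x φ

/-! ### Translation covariance -/

/-- Translation invariance of a lattice covariance: `C_{u+v,u'+v} = C_{u,u'}`. [cite: Slade2017, §3.1 (the decomposition is translation invariant)] -/
def TransInv (C : TorusSite d M → TorusSite d M → ℝ) : Prop := ∀ u u' v, C (u + v) (u' + v) = C u u'

/-- **`E_v(Δ_C F) = Δ_C(E_v F)`** for a translation-invariant covariance. [folklore] -/
theorem transN_lapC {C : TorusSite d M → TorusSite d M → ℝ} (hC : TransInv C) (v : TorusSite d M)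
    {F : (TorusSite d M → Fin n → ℝ) → ℝ} (hF : ContDiff ℝ ∞ F) :
    transN v (lapC (basisDir d M n) (lapCov C) F) = lapC (basisDir d M n) (lapCov C) (transN v F) := by
  funext φ
  simp only [transN, lapC]
  -- `(E F)_{[p,q]} = E(F_{[p-v,q-v]})`; reindex the double sum by the translation
  have hcoeff : ∀ p q : TorusSite d M × Fin n, coeff (basisDir d M n) [p, q] (transN v F) φ =
      coeff (basisDir d M n) [(p.1 - v, p.2), (q.1 - v, q.2)] F (shiftField v φ) := by
    intro p q
    have h := congrFun (coeff_transN v hF [(p.1 - v, p.2), (q.1 - v, q.2)]) φ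
    simp only [shiftSeq, List.map_cons, List.map_nil, sub_add_cancel, Prod.mk.eta, transN] at h
    exact h
  show ∑ p, ∑ q, lapCov C p q * coeff (basisDir d M n) [p, q] F (shiftField v φ) =
    ∑ p, ∑ q, lapCov C p q * coeff (basisDir d M n) [p, q] (transN v F) φ
  simp only [hcoeff]
  symm
  refine Fintype.sum_equiv ((Equiv.subRight v).prodCongr (Equiv.refl (Fin n))) _ _ fun p => ?_
  refine Fintype.sum_equiv ((Equiv.subRight v).prodCongr (Equiv.refl (Fin n))) _ _ fun q => ?_
  simp only [Equiv.prodCongr_apply, Prod.map_fst, Prod.map_snd, Equiv.subRight_apply, Equiv.refl_apply, lapCov]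
  congr 1
  by_cases h : p.2 = q.2
  · rw [if_pos h, if_pos h, ← hC (p.1 - v) (q.1 - v) v, sub_add_cancel, sub_add_cancel]
  · rw [if_neg h, if_neg h]

/-- `E_v(Δ_C^k F) = Δ_C^k(E_v F)`. [folklore] -/
theorem transN_lapPow {C : TorusSite d M → TorusSite d M → ℝ} (hC : TransInv C) (v : TorusSite d M)
    {F : (TorusSite d M → Fin n → ℝ) → ℝ} (hF : ContDiff ℝ ∞ F) :
    ∀ k : ℕ, transN v (lapPow (basisDir d M n) (lapCov C) k F) = lapPow (basisDir d M n) (lapCov C) k (transN v F)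
  | 0 => rfl
  | k + 1 => by
      rw [lapPow_succ, lapPow_succ, transN_lapC hC v (contDiff_lapPow _ _ hF k), transN_lapPow hC v hF k]

/-- **`E_v(e^{tΔ_C}F) = e^{tΔ_C}(E_v F)`.** [folklore] -/
theorem transN_expL {C : TorusSite d M → TorusSite d M → ℝ} (hC : TransInv C) (A : ℕ) (t : ℝ) (v : TorusSite d M)
    {F : (TorusSite d M → Fin n → ℝ) → ℝ} (hF : ContDiff ℝ ∞ F) :
    transN v (expL C A t F) = expL C A t (transN v F) := by
  funext φ
  simp only [transN, expL, expLap]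
  refine Finset.sum_congr rfl fun k _ => ?_
  have h := congrFun (transN_lapPow hC v hF k) φ
  simp only [transN] at h
  rw [h]

/-- **`E_v F_C(A,B) = F_C(E_vA, E_vB)`.** [folklore] -/
theorem transN_FC {C : TorusSite d M → TorusSite d M → ℝ} (hC : TransInv C) (A : ℕ) (v : TorusSite d M)
    {P Q : (TorusSite d M → Fin n → ℝ) → ℝ} (hP : ContDiff ℝ ∞ P) (hQ : ContDiff ℝ ∞ Q) :
    transN v (FC C A P Q) = FC C A (transN v P) (transN v Q) := by
  have hPQ : ContDiff ℝ ∞ (fun ψ => expL C A (-2⁻¹) P ψ * expL C A (-2⁻¹) Q ψ) :=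
    (contDiff_expL C A (-2⁻¹) hP).mul (contDiff_expL C A (-2⁻¹) hQ)
  have h1 := transN_expL hC A 2⁻¹ v hPQ
  have hprod : transN v (fun ψ => expL C A (-2⁻¹) P ψ * expL C A (-2⁻¹) Q ψ) =
      fun ψ => expL C A (-2⁻¹) (transN v P) ψ * expL C A (-2⁻¹) (transN v Q) ψ := by
    rw [← transN_expL hC A (-2⁻¹) v hP, ← transN_expL hC A (-2⁻¹) v hQ]
    rfl
  rw [hprod] at h1
  funext φ
  have h1' := congrFun h1 φ
  unfold transN at h1' ⊢
  unfold FC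
  rw [h1']

omit [NeZero M] in
/-- `E_v V_x = V_{x+v}` for the local polynomial. [folklore] -/
theorem transN_localPoly (v : TorusSite d M) (g ν u : ℝ) (x : TorusSite d M) :
    transN (n := n) v (localPoly g ν u x) = localPoly g ν u (x + v) := by
  funext φ; simp [transN, localPoly, tau]

/-- `E_v V(Λ) = V(Λ)`. [folklore] -/
theorem transN_localPolySum_univ (v : TorusSite d M) (g ν u : ℝ) :
    transN (n := n) v (localPolySum g ν u univ) = localPolySum g ν u univ := by
  funext φ
  simp only [transN, localPolySum]
  have h : ∀ x, localPoly (n := n) g ν u x (shiftField v φ) = localPoly g ν u (x + v) φ :=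
    fun x => congrFun (transN_localPoly (n := n) v g ν u x) φ
  simp only [h]
  exact Fintype.sum_equiv (Equiv.addRight v) _ _ fun x => rfl

/-- **`E_v(Loc_x G) = Loc_{x+v}(E_v G)`.** [cite: BrydgesSlade2015RGII, Proposition 1.4.3 (translations)] -/
theorem transN_locPt (pN : ℕ) (dφ dplus : ℝ) (v x : TorusSite d M) {G : (TorusSite d M → Fin n → ℝ) → ℝ}
    (hG : ContDiff ℝ ∞ G) : transN v (locPt pN dφ dplus x G) = locPt pN dφ dplus (x + v) (transN v G) := by
  unfold locPt
  rw [transN_locX pN dφ dplus x v {x} hG, Finset.image_singleton]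

/-- `Loc_x G` is smooth. [folklore] -/
theorem contDiff_locPt (pN : ℕ) (dφ dplus : ℝ) (x : TorusSite d M) (G : (TorusSite d M → Fin n → ℝ) → ℝ) :
    ContDiff ℝ ∞ (locPt pN dφ dplus x G) :=
  contDiff_locX pN dφ dplus x {x} G

/-- **`E_v W_j(V,x) = W_j(V,x+v)`.** [cite: Slade2017, §4.3 ("by translation invariance")] -/
theorem transN_Wfun (pN : ℕ) (dφ dplus : ℝ) {w : TorusSite d M → TorusSite d M → ℝ} (hw : TransInv w) (A : ℕ)
    (g ν u : ℝ) (v x : TorusSite d M) :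
    transN (n := n) v (Wfun pN dφ dplus w A g ν u x) = Wfun pN dφ dplus w A g ν u (x + v) := by
  have hVΛ : ContDiff ℝ ∞ (localPolySum (d := d) (M := M) (n := n) g ν u univ) :=
    ContDiff.sum fun y _ => contDiff_localPoly g ν u y
  have hF : ContDiff ℝ ∞ (FC w A (localPoly (n := n) g ν u x) (localPolySum g ν u univ)) :=
    contDiff_FC w A (contDiff_localPoly g ν u x) hVΛ
  have h1 := transN_FC hw A v (contDiff_localPoly (n := n) g ν u x) hVΛ
  rw [transN_localPoly, transN_localPolySum_univ v g ν u] at h1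
  have h2 := transN_locPt pN dφ dplus v x hF
  rw [h1] at h2
  funext φ
  have h1' := congrFun h1 φ
  have h2' := congrFun h2 φ
  simp only [transN] at h1' h2' ⊢
  simp only [Wfun]
  rw [h1', h2']

/-- `W_j(V,x)` is smooth. [folklore] -/
theorem contDiff_Wfun (pN : ℕ) (dφ dplus : ℝ) (w : TorusSite d M → TorusSite d M → ℝ) (A : ℕ) (g ν u : ℝ) (x : TorusSite d M) :
    ContDiff ℝ ∞ (Wfun (n := n) pN dφ dplus w A g ν u x) := by
  have hVΛ : ContDiff ℝ ∞ (localPolySum (d := d) (M := M) (n := n) g ν u univ) :=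
    ContDiff.sum fun y _ => contDiff_localPoly g ν u y
  have hF : ContDiff ℝ ∞ (FC w A (localPoly (n := n) g ν u x) (localPolySum g ν u univ)) :=
    contDiff_FC w A (contDiff_localPoly g ν u x) hVΛ
  exact contDiff_const.mul (hF.sub (contDiff_locPt pN dφ dplus x _))

/-- **`E_v P_j(V)_x = P_j(V)_{x+v}`.** [cite: Slade2017, §4.3 ("by translation invariance, P_j(V)_x does define a local polynomial with coefficients independent of x")] -/
theorem transN_Pfun (pN : ℕ) (dφ dplus : ℝ) {C w : TorusSite d M → TorusSite d M → ℝ} (hC : TransInv C) (hw : TransInv w)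
    (A : ℕ) (g ν u : ℝ) (v x : TorusSite d M) :
    transN (n := n) v (Pfun pN dφ dplus C w A g ν u x) = Pfun pN dφ dplus C w A g ν u (x + v) := by
  have hW := contDiff_Wfun (n := n) pN dφ dplus w A g ν u x
  have hVx := contDiff_localPoly (d := d) (M := M) (n := n) g ν u x
  have hVΛ : ContDiff ℝ ∞ (localPolySum (d := d) (M := M) (n := n) g ν u univ) := ContDiff.sum fun y _ => contDiff_localPoly g ν u y
  have hG : ContDiff ℝ ∞ (fun φ => expL C A 2⁻¹ (Wfun (n := n) pN dφ dplus w A g ν u x) φ +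
      2⁻¹ * FC C A (expL C A 2⁻¹ (localPoly g ν u x)) (expL C A 2⁻¹ (localPolySum g ν u univ)) φ) :=
    (contDiff_expL C A _ hW).add (contDiff_const.mul (contDiff_FC C A (contDiff_expL C A _ hVx) (contDiff_expL C A _ hVΛ)))
  unfold Pfun
  rw [transN_locPt pN dφ dplus v x hG]
  congr 1
  have h1 := transN_expL hC A 2⁻¹ v hW
  rw [transN_Wfun pN dφ dplus hw A g ν u v x] at h1
  have h2 := transN_FC hC A v (contDiff_expL C A 2⁻¹ hVx) (contDiff_expL C A 2⁻¹ hVΛ)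
  rw [transN_expL hC A _ v hVx, transN_expL hC A _ v hVΛ, transN_localPoly, transN_localPolySum_univ] at h2
  funext φ
  have h1' := congrFun h1 φ
  have h2' := congrFun h2 φ
  simp only [transN] at h1' h2' ⊢
  rw [h1', h2']

/-- **The coefficients of `P_j(V)_x` (and hence of `φ_pt(V)_x`) in the basis `P̂_C({x})` do not
depend on `x`.** [cite: Slade2017, §4.3 (the sentence after display (4.14))] -/
theorem betaVec_Pfun_add (pN : ℕ) (dφ dplus : ℝ) {C w : TorusSite d M → TorusSite d M → ℝ} (hC : TransInv C) (hw : TransInv w)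
    (A : ℕ) (g ν u : ℝ) (x v : TorusSite d M)
    (G : TorusSite d M → (TorusSite d M → Fin n → ℝ) → ℝ)
    (hGdef : ∀ y, G y = fun φ => expL C A 2⁻¹ (Wfun (n := n) pN dφ dplus w A g ν u y) φ +
      2⁻¹ * FC C A (expL C A 2⁻¹ (localPoly g ν u y)) (expL C A 2⁻¹ (localPolySum g ν u univ)) φ) :
    betaVec pN dφ dplus (x + v) {x + v} (G (x + v)) = betaVec (n := n) pN dφ dplus x {x} (G x) := by
  -- `G_{x+v} = E_v G_x`
  have hW := contDiff_Wfun (n := n) pN dφ dplus w A g ν u x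
  have hVx := contDiff_localPoly (d := d) (M := M) (n := n) g ν u x
  have hVΛ : ContDiff ℝ ∞ (localPolySum (d := d) (M := M) (n := n) g ν u univ) := ContDiff.sum fun y _ => contDiff_localPoly g ν u y
  have hGs : ContDiff ℝ ∞ (G x) := by
    rw [hGdef]
    exact (contDiff_expL C A _ hW).add (contDiff_const.mul (contDiff_FC C A (contDiff_expL C A _ hVx) (contDiff_expL C A _ hVΛ)))
  have hcov : G (x + v) = transN v (G x) := by
    rw [hGdef, hGdef]
    have h1 := transN_expL hC A 2⁻¹ v hW
    rw [transN_Wfun pN dφ dplus hw A g ν u v x] at h1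
    have h2 := transN_FC hC A v (contDiff_expL C A 2⁻¹ hVx) (contDiff_expL C A 2⁻¹ hVΛ)
    rw [transN_expL hC A _ v hVx, transN_expL hC A _ v hVΛ, transN_localPoly, transN_localPolySum_univ] at h2
    funext φ
    have h1' := congrFun h1 φ
    have h2' := congrFun h2 φ
    simp only [transN] at h1' h2' ⊢
    rw [h1', h2']
  rw [hcov]
  unfold betaVec
  rw [alphaVec_transN pN dφ dplus x v hGs, ← Finset.image_singleton (· + v) x, Bmat_transN]

end PTFun

end LongRangePhi4

end Literature.Barriers.CriticalPhenomena

end
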